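import Mathlib

/-! # Lifted-ring plumbing for `stub_dissocBridge` — crux `TwoProducts` (stmt-ValiantsHypothesis-5906),
line `corner-log-linearization`, rung piece R3 (lead c3), part 1 of 2

Lift one variable `z_a` per letter `a ∈ U ⊂ ℕ²` (letters = exponent vectors), i.e. work in `MvPolynomial (Fin 2 →₀ ℕ) ℂ`,
with the projection `π : z_a ↦ x^a` (the algebra map `aeval (a ↦ monomial a 1)`) and the exponent map `φ(m) = Σ_a m_a • a`.
The lifted tail of a factor `f` is the linear form `Σ_{a ∈ U} (coeff_a f) z_a = σ_c(Σ_{a∈U} z_a)` (`σ_c` the scaling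
`z_a ↦ c_a z_a`), so `coeff_m` of its `r`-th power is `c^m · Mult_r(m)` with the universal multinomial coefficient
`Mult_r(m) = coeff_m((Σ_{a∈U} z_a)^r)`, which is nonzero iff `|m| = r` and `supp m ⊆ U` (induction on `r` via
`coeff (p * X a)`); consequently `K_R(m) = Σ_{r=1}^R κ_r Mult_r(m) ≠ 0` for `1 ≤ |m| ≤ R` (`κ_r = (−1)^{r+1}/r`), and
`coeff_p π(G) = Σ_{φ(m) = p} coeff_m G`.  Everything is def-free (objects inlined). [folklore] -/

set_option linter.dupNamespace false

namespace Summit.ValiantsHypothesis.ValiantsHypothesis.Theorems.TwoProducts.DissocLift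

open scoped BigOperators
open MvPolynomial

/-- `π` sends the lifted monomial `z^m` to the monomial `x^{φ(m)}`. [folklore] -/
theorem proj_monomial (m : (Fin 2 →₀ ℕ) →₀ ℕ) (b : ℂ) : aeval (fun a : Fin 2 →₀ ℕ => (monomial a (1 : ℂ) : MvPolynomial (Fin 2) ℂ)) (monomial m b) = monomial ((Finsupp.sum m fun a k => k • a)) b := by
  rw [aeval_monomial]
  have : (m.prod fun a k => (monomial a (1 : ℂ) : MvPolynomial (Fin 2) ℂ) ^ k) =
      m.prod fun a k => monomial (k • a) 1 := by
    refine Finsupp.prod_congr fun a _ => ?_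
    rw [monomial_pow, one_pow]
  rw [this, monomial_finsupp_sum_index, algebraMap_eq]

/-- Coefficients of a projection: `coeff_p π(G) = Σ_{m ∈ supp G, φ(m) = p} coeff_m G`. [folklore] -/
theorem coeff_proj (G : MvPolynomial (Fin 2 →₀ ℕ) ℂ) (p : (Fin 2 →₀ ℕ)) :
    coeff p (aeval (fun a : Fin 2 →₀ ℕ => (monomial a (1 : ℂ) : MvPolynomial (Fin 2) ℂ)) G) = ∑ m ∈ G.support with (Finsupp.sum m fun a k => k • a) = p, coeff m G := by
  conv_lhs => rw [G.as_sum, map_sum]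
  rw [coeff_sum, Finset.sum_filter]
  refine Finset.sum_congr rfl fun m _ => ?_
  rw [proj_monomial, coeff_monomial]

/-- `σ_c` multiplies the monomial `z^m` by `c^m`. [folklore] -/
theorem scale_monomial (c : (Fin 2 →₀ ℕ) → ℂ) (m : (Fin 2 →₀ ℕ) →₀ ℕ) (b : ℂ) :
    aeval (fun a : Fin 2 →₀ ℕ => (C (c a) * X a : MvPolynomial (Fin 2 →₀ ℕ) ℂ)) (monomial m b) = monomial m (b * (Finsupp.prod m fun a k => c a ^ k)) := by
  rw [aeval_monomial, algebraMap_eq]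
  have : (m.prod fun a k => (C (c a) * X a : MvPolynomial (Fin 2 →₀ ℕ) ℂ) ^ k) =
      C (m.prod fun a k => c a ^ k) * m.prod fun a k => (X a : MvPolynomial (Fin 2 →₀ ℕ) ℂ) ^ k := by
    simp only [Finsupp.prod, mul_pow, Finset.prod_mul_distrib, map_prod, map_pow]
  rw [this, ← mul_assoc, ← C_mul, ← monomial_eq]

/-- Coefficients of a scaled polynomial: `coeff_m σ_c(G) = c^m · coeff_m G`. [folklore] -/
theorem coeff_scale (c : (Fin 2 →₀ ℕ) → ℂ) (G : MvPolynomial (Fin 2 →₀ ℕ) ℂ) (m : (Fin 2 →₀ ℕ) →₀ ℕ) :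
    coeff m (aeval (fun a : Fin 2 →₀ ℕ => (C (c a) * X a : MvPolynomial (Fin 2 →₀ ℕ) ℂ)) G) = (Finsupp.prod m fun a k => c a ^ k) * coeff m G := by
  conv_lhs => rw [G.as_sum, map_sum]
  rw [coeff_sum]
  simp_rw [scale_monomial, coeff_monomial]
  rw [Finset.sum_ite_eq']
  split_ifs with h
  · ring
  · rw [notMem_support_iff.mp h, mul_zero]

/-- The lifted tail `Σ_{a ∈ U} (c a) z_a` is the scaling of the universal linear form `Σ_{a ∈ U} z_a`. [folklore] -/
theorem lift_eq_scale (U : Finset (Fin 2 →₀ ℕ)) (c : (Fin 2 →₀ ℕ) → ℂ) :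
    (∑ a ∈ U, C (c a) * X a : MvPolynomial (Fin 2 →₀ ℕ) ℂ) =
      aeval (fun a : Fin 2 →₀ ℕ => (C (c a) * X a : MvPolynomial (Fin 2 →₀ ℕ) ℂ))
        (∑ a ∈ U, X a : MvPolynomial (Fin 2 →₀ ℕ) ℂ) := by
  rw [map_sum]
  refine Finset.sum_congr rfl fun a _ => ?_
  rw [aeval_X]

/-- Coefficients of powers of a lifted tail: `coeff_m (Σ_a c_a z_a)^r = c^m · Mult_r(m)`. [folklore] -/
theorem coeff_lift_pow (U : Finset (Fin 2 →₀ ℕ)) (c : (Fin 2 →₀ ℕ) → ℂ) (r : ℕ) (m : (Fin 2 →₀ ℕ) →₀ ℕ) :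
    coeff m ((∑ a ∈ U, C (c a) * X a : MvPolynomial (Fin 2 →₀ ℕ) ℂ) ^ r) = (Finsupp.prod m fun a k => c a ^ k) * coeff (m) ((∑ a ∈ U, X a : MvPolynomial (Fin 2 →₀ ℕ) ℂ) ^ (r)) := by
  rw [lift_eq_scale, ← map_pow, coeff_scale]

/-- Recursion for the universal multinomial coefficients: `Mult_{r+1}(m) = Σ_{a ∈ U ∩ supp m} Mult_r(m − e_a)`.
[folklore] -/
theorem mult_succ (U : Finset (Fin 2 →₀ ℕ)) (r : ℕ) (m : (Fin 2 →₀ ℕ) →₀ ℕ) :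
    coeff (m) ((∑ a ∈ U, X a : MvPolynomial (Fin 2 →₀ ℕ) ℂ) ^ (r + 1)) = ∑ a ∈ U, if a ∈ m.support then coeff (m - Finsupp.single a 1) ((∑ a ∈ U, X a : MvPolynomial (Fin 2 →₀ ℕ) ℂ) ^ (r)) else 0 := by
  classical
  rw [pow_succ, Finset.mul_sum, coeff_sum]
  refine Finset.sum_congr rfl fun a _ => ?_
  rw [coeff_mul_X']

/-- The universal multinomial coefficients are natural numbers. [folklore] -/
theorem mult_natCast (U : Finset (Fin 2 →₀ ℕ)) : ∀ (r : ℕ) (m : (Fin 2 →₀ ℕ) →₀ ℕ), ∃ k : ℕ, coeff (m) ((∑ a ∈ U, X a : MvPolynomial (Fin 2 →₀ ℕ) ℂ) ^ (r)) = k := by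
  classical
  intro r
  induction r with
  | zero =>
    intro m
    rw [pow_zero, coeff_one]
    split_ifs
    · exact ⟨1, by simp⟩
    · exact ⟨0, by simp⟩
  | succ r ih =>
    intro m
    choose k hk using ih
    refine ⟨∑ a ∈ U, if a ∈ m.support then k (m - Finsupp.single a 1) else 0, ?_⟩
    rw [mult_succ, Nat.cast_sum]
    refine Finset.sum_congr rfl fun a _ => ?_
    split_ifs <;> simp [hk]

/-- Degree bookkeeping: removing one copy of a letter lowers the size by one. [folklore] -/
theorem degree_tsub_single {m : (Fin 2 →₀ ℕ) →₀ ℕ} {a : (Fin 2 →₀ ℕ)} (ha : a ∈ m.support) :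
    (m - Finsupp.single a 1).degree + 1 = m.degree := by
  have h : m - Finsupp.single a 1 + Finsupp.single a 1 = m := by
    refine tsub_add_cancel_of_le ?_
    rw [Finsupp.single_le_iff]
    exact Nat.one_le_iff_ne_zero.mpr (Finsupp.mem_support_iff.mp ha)
  conv_rhs => rw [← h]
  rw [map_add, Finsupp.degree_single]

/-- Support of the universal multinomial coefficients: `Mult_r(m) ≠ 0` forces `supp m ⊆ U` and `|m| = r`.
[folklore] -/
theorem mult_ne_zero_imp (U : Finset (Fin 2 →₀ ℕ)) : ∀ (r : ℕ) (m : (Fin 2 →₀ ℕ) →₀ ℕ), coeff (m) ((∑ a ∈ U, X a : MvPolynomial (Fin 2 →₀ ℕ) ℂ) ^ (r)) ≠ 0 →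
    m.support ⊆ U ∧ m.degree = r := by
  classical
  intro r
  induction r with
  | zero =>
    intro m hm
    rw [pow_zero, coeff_one] at hm
    split_ifs at hm with h
    · subst h; simp
    · exact absurd rfl hm
  | succ r ih =>
    intro m hm
    rw [mult_succ] at hm
    obtain ⟨a, haU, hne⟩ := Finset.exists_ne_zero_of_sum_ne_zero hm
    split_ifs at hne with ha
    · obtain ⟨hsub, hdeg⟩ := ih _ hne
      refine ⟨fun b hb => ?_, ?_⟩
      · by_cases hba : b = a
        · exact hba ▸ haU
        · refine hsub ?_
          rw [Finsupp.mem_support_iff] at hb ⊢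
          rw [Finsupp.tsub_apply, Finsupp.single_apply, if_neg (fun h => hba h.symm), tsub_zero]
          exact hb
      · rw [← degree_tsub_single ha, hdeg]
    · exact absurd rfl hne

/-- Positivity of the universal multinomial coefficients on their natural support. [folklore] -/
theorem mult_ne_zero (U : Finset (Fin 2 →₀ ℕ)) : ∀ (r : ℕ) (m : (Fin 2 →₀ ℕ) →₀ ℕ), m.support ⊆ U → m.degree = r →
    coeff (m) ((∑ a ∈ U, X a : MvPolynomial (Fin 2 →₀ ℕ) ℂ) ^ (r)) ≠ 0 := by
  classical
  intro r
  induction r with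
  | zero =>
    intro m _ hdeg
    rw [Finsupp.degree_eq_zero_iff] at hdeg
    subst hdeg
    rw [pow_zero, coeff_one, if_pos rfl]
    exact one_ne_zero
  | succ r ih =>
    intro m hsub hdeg
    have hm0 : m ≠ 0 := by
      rintro rfl
      rw [map_zero] at hdeg
      exact absurd hdeg (by omega)
    obtain ⟨a, ha⟩ := Finsupp.support_nonempty_iff.mpr hm0
    choose k hk using mult_natCast U r
    rw [mult_succ]
    have hterm : ∀ b ∈ U, (if b ∈ m.support then coeff (m - Finsupp.single b 1) ((∑ a ∈ U, X a : MvPolynomial (Fin 2 →₀ ℕ) ℂ) ^ (r)) else 0) =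
        ((if b ∈ m.support then k (m - Finsupp.single b 1) else 0 : ℕ) : ℂ) := by
      intro b _
      split_ifs <;> simp [hk]
    rw [Finset.sum_congr rfl hterm, ← Nat.cast_sum, Nat.cast_ne_zero]
    have hka : k (m - Finsupp.single a 1) ≠ 0 := by
      have h1 : coeff (m - Finsupp.single a 1) ((∑ a ∈ U, X a : MvPolynomial (Fin 2 →₀ ℕ) ℂ) ^ (r)) ≠ 0 := by
        refine ih _ (fun b hb => hsub ?_) ?_
        · rw [Finsupp.mem_support_iff] at hb ⊢
          rw [Finsupp.tsub_apply] at hb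
          exact fun h0 => hb (by rw [h0, zero_tsub])
        · have := degree_tsub_single ha
          omega
      rwa [hk, Nat.cast_ne_zero] at h1
    have hle : (if a ∈ m.support then k (m - Finsupp.single a 1) else 0) ≤
        ∑ x ∈ U, (if x ∈ m.support then k (m - Finsupp.single x 1) else 0) :=
      Finset.single_le_sum (f := fun x => if x ∈ m.support then k (m - Finsupp.single x 1) else 0)
        (fun b _ => Nat.zero_le _) (hsub ha)
    rw [if_pos ha] at hle
    exact Nat.ne_of_gt (Nat.lt_of_lt_of_le (Nat.pos_of_ne_zero hka) hle)

/-- `K_R(m) ≠ 0` for `1 ≤ |m| ≤ R` and `supp m ⊆ U`. [folklore] -/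
theorem KR_ne_zero (U : Finset (Fin 2 →₀ ℕ)) (R : ℕ) (m : (Fin 2 →₀ ℕ) →₀ ℕ) (hsub : m.support ⊆ U)
    (h1 : 1 ≤ m.degree) (hR : m.degree ≤ R) : (∑ r ∈ Finset.Icc 1 R, ((-1 : ℂ) ^ (r + 1) / (r : ℂ)) * coeff (m) ((∑ a ∈ U, X a : MvPolynomial (Fin 2 →₀ ℕ) ℂ) ^ (r))) ≠ 0 := by
  rw [Finset.sum_eq_single m.degree]
  · refine mul_ne_zero (div_ne_zero (pow_ne_zero _ (by norm_num)) ?_) (mult_ne_zero U _ m hsub rfl)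
    exact_mod_cast (show m.degree ≠ 0 by omega)
  · intro r _ hr
    have : coeff (m) ((∑ a ∈ U, X a : MvPolynomial (Fin 2 →₀ ℕ) ℂ) ^ (r)) = 0 := by
      by_contra h
      exact hr (mult_ne_zero_imp U r m h).2.symm
    rw [this, mul_zero]
  · intro h
    exact absurd (Finset.mem_Icc.mpr ⟨h1, hR⟩) h

/-- `K_R(m) ≠ 0` forces `supp m ⊆ U` and `1 ≤ |m| ≤ R`. [folklore] -/
theorem KR_ne_zero_imp (U : Finset (Fin 2 →₀ ℕ)) (R : ℕ) (m : (Fin 2 →₀ ℕ) →₀ ℕ) (hK : (∑ r ∈ Finset.Icc 1 R, ((-1 : ℂ) ^ (r + 1) / (r : ℂ)) * coeff (m) ((∑ a ∈ U, X a : MvPolynomial (Fin 2 →₀ ℕ) ℂ) ^ (r))) ≠ 0) :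
    m.support ⊆ U ∧ 1 ≤ m.degree ∧ m.degree ≤ R := by
  obtain ⟨r, hr, hne⟩ := Finset.exists_ne_zero_of_sum_ne_zero hK
  obtain ⟨hsub, hdeg⟩ := mult_ne_zero_imp U r m (right_ne_zero_of_mul hne)
  rw [Finset.mem_Icc] at hr
  exact ⟨hsub, hdeg ▸ hr.1, hdeg ▸ hr.2⟩

/-- A polynomial with constant term `1` projects from its lifted tail: `π(Σ_{a∈U} (coeff_a f) z_a) = f − 1` whenever
`0 ∉ U` and the nonzero support of `f` lies in `U`. [folklore] -/
theorem proj_liftTail (U : Finset (Fin 2 →₀ ℕ)) (f : MvPolynomial (Fin 2) ℂ) (hf : coeff 0 f = 1) (h0 : (0 : (Fin 2 →₀ ℕ)) ∉ U)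
    (hsupp : ∀ a ∈ f.support, a ≠ 0 → a ∈ U) :
    aeval (fun a : Fin 2 →₀ ℕ => (monomial a (1 : ℂ) : MvPolynomial (Fin 2) ℂ)) (∑ a ∈ U, C (coeff a f) * X a : MvPolynomial (Fin 2 →₀ ℕ) ℂ) = f - 1 := by
  classical
  rw [map_sum]
  have h1 : ∀ a ∈ U, aeval (fun a : Fin 2 →₀ ℕ => (monomial a (1 : ℂ) : MvPolynomial (Fin 2) ℂ)) (C (coeff a f) * X a : MvPolynomial (Fin 2 →₀ ℕ) ℂ) = monomial a (coeff a f) := by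
    intro a _
    rw [map_mul, aeval_C, aeval_X, algebraMap_eq, C_mul_monomial, mul_one]
  rw [Finset.sum_congr rfl h1]
  have h2 : ∑ a ∈ U, monomial a (coeff a f) = ∑ a ∈ f.support.erase 0, monomial a (coeff a f) := by
    refine (Finset.sum_subset ?_ ?_).symm
    · intro a ha
      rw [Finset.mem_erase] at ha
      exact hsupp a ha.2 ha.1
    · intro a haU ha
      have : coeff a f = 0 := by
        by_contra hne
        by_cases ha0 : a = 0
        · exact h0 (ha0 ▸ haU)
        · exact ha (Finset.mem_erase.mpr ⟨ha0, mem_support_iff.mpr hne⟩)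
      rw [this, monomial_zero]
  rw [h2]
  have h3 : f = ∑ a ∈ f.support, monomial a (coeff a f) := f.as_sum
  have h0f : (0 : (Fin 2 →₀ ℕ)) ∈ f.support := mem_support_iff.mpr (by rw [hf]; exact one_ne_zero)
  conv_rhs => rw [h3, ← Finset.add_sum_erase _ _ h0f]
  rw [hf]
  change _ = C 1 + _ - 1
  rw [C_1, add_sub_cancel_left]

/-- **Registered form** (rung piece R3a): `K_R(m) ≠ 0` for `1 ≤ |m| ≤ R`, `supp m ⊆ U`. [folklore] -/
theorem stub_dissocLift : ∀ (U : Finset (Fin 2 →₀ ℕ)) (R : ℕ) (m : (Fin 2 →₀ ℕ) →₀ ℕ),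
    m.support ⊆ U → 1 ≤ m.degree → m.degree ≤ R →
    (∑ r ∈ Finset.Icc 1 R, ((-1 : ℂ) ^ (r + 1) / (r : ℂ)) *
      MvPolynomial.coeff m ((∑ a ∈ U, MvPolynomial.X a : MvPolynomial (Fin 2 →₀ ℕ) ℂ) ^ r)) ≠ 0 :=
  fun U R m hsub h1 hR => KR_ne_zero U R m hsub h1 hR

end Summit.ValiantsHypothesis.ValiantsHypothesis.Theorems.TwoProducts.DissocLift
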